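import Summits.QuantumFields.BalabanUV.Beta.GAN24.CombChartCubicCellChargeZero
import Summits.QuantumFields.BalabanUV.Beta.GAN24.CombQuarticContactChargeZero
import Summits.QuantumFields.BalabanUV.Beta.SymSecondOrderSplitLoc
import Summits.QuantumFields.BalabanUV.Beta.DshAn1Spread

/-!
# `BalabanUV.Beta.GAN24.CombChartQuarticContactChargeZero` — binder row G-an2-4 ∕ (CONV-C), TRANSFER-III, row (C) at levels ≥ 1, THE PARITY ROUTE AT THE (III′) COMB CHART (second half):
# **THE CONTACT DEFECT OF THE COMB-CHART TOWER's QUARTIC REFLECTION LAW CARRIES NO ff CHARGE — ANY PATTERN, EVERY LEVEL, AT THE PIN**, for ANY sym record `tabs : SymTables 3 Lc`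
# with an1's first-order reflection letters (V-r)(V-ff0)(H-r) displayed and ANY second symbol `diagK (h κ u κ′ u′)` that is a local bi-stencil family with a finitely supported field leg
# (an2's comb law `SpineRecursiveT2AllComb.T2RecOf_bref_all_of_letters_comb` carries exactly such a letter `h j α`); the canonical product symbol and an1's record as corollaries
# (the (III′) twin of road-P2 g48's `CombQuarticContactChargeZero.zmode_conjW_comb_eq_zero`; OWNER `b2b-balaban-gan24-p1`, gen 51, sizing memo `gen51/M-ODD-HALF-SIZING-g51.md` M2′)

NOT IN PRINT; OUR BOOKKEEPING ([folklore] composition BY NAME: road-P2 g48's GENERIC §1–§4 of `CombQuarticContactChargeZero` (`zmode_conjW₁_eq_zero`, `zmode_conjW₂_eq_zero`, the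
zero-letter classes `conjW_zero_sandwich ∕ conjW_zero_letters ∕ decays_zero' ∕ locStencil₂_zero'`) and an2's `SecondOrderBorderClassKit.locStencil₂_conjW`, fed with the (III′) letters:
MY (M1′) `CombChartCubicCellChargeZero` (the cubic cell charges of `SpureCombOf` vanish; the shifted spread's ff Ward zeros ∕ summabilities; `mul_ctGenM_inl`), an2's
`CombChartStepJets.locStencil_SpureCombOf ∕ SpureCombOf_translate`, `SymShiftedSpread.spr_bhKStepSh` with an1's `DshAn1Spread.spr_Dsh`, `SymSecondOrderSplitLoc.locStencil_diagK_mul_ctGenM ∕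
locStencil₂_diagK_ctGenM_mul_ctGenM`, `E3ContactGenerator.ctGenM_inl`; 0 `def`, 0 cited facts, 0 `def … : Prop`, 0 sorry; no existing file touched).
HONEST FRAMING (cell contract, verbatim): «discharging `BetaPertH` makes Bałaban's UV stability UNCONDITIONAL — a real constructive-QFT result; it is NOT the continuum limit and NOT the
Clay problem.»  HONEST DEPENDENCY (verbatim): «continuum YM on T⁴ ⇐ BetaPertH ∧ nine spine estimates (0/9 proved); BetaPertH ⇐ (D1) ∧ (D4) ∧ CAP+tail; G-an2-4 gates asym, D1 and
NE2/3/4.»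
THE OBJECT.  an2's (III′) quartic law reflects the comb-chart member `T̃′_j` along the axis `α` with the DEFECT `J κ u κ′ u′ = conjW 𝕄′_j (S′_j κ u) (S′_j κ′ u′) (X κ u) (X κ′ u′) (X₂ κ u κ′ u′)
+ R2`, `𝕄′_j = bhKStepSh 3 Lc (Dsh Lc) j` (an1's shifted straight spread), `S′_j = SpureCombOf tabs Lc⁴ (−Lc⁸∕2) cΛ j`, LEGGED generators `X κ u = diagK (γ·ctGenM 3 (bhK Lc + Dsh Lc) α Lc κ u)`,
second symbol `X₂ = diagK (h κ u κ′ u′)`.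
WHAT: **`zmode_conjW_combChart_eq_zero`** (any `tabs` with (V-r)(V-ff0)(H-r), any `γ`, any `h` with `LocStencil₂ (diagK ∘ h)` and finitely supported field leg), `zmode_conjW_combChart_canon_eq_zero`
(`h = (γ₂·ctGenM κ u)·(γ₂′·ctGenM κ′ u′)`, both side conditions discharged), `zmode_conjW_combChart_an1_eq_zero` (an1's record `symTablesAn1S2 3 Lc cΛt`, hypotheses `Odd Lc` only,
generic `h`).  WHAT THIS IS NOT: the odd-class vanishing itself (M3′: needs the law DISPLAYED in comb letters) and the record's quartic TABLE law (M4 = W-an2-1′) are NOT here; asserts NO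
value; NEVER «G-an2-4 closed» as (CONV-C); NOT D1, NOT `BetaPertH`, NOT continuum, NOT Clay; not in print.  2026-08-27.
-/

noncomputable section

open Finset
open scoped BigOperators
open Literature.MathematicalPhysics.QuantumFieldTheory
open Literature.MathematicalPhysics.QuantumFieldTheory.Balaban1983to89
open Literature.MathematicalPhysics.QuantumFieldTheory.Balaban1983to89.Beta
open ExpKernelCalculus (MKer shiftK BiLoc Decays)
open OneStepResolventKernel (Fib LocStencil)
open BalabanStepJets (locStencil_mono)
open OneStepResolventKernel (decays_mono)
open AffineAveraging (box toSite)
open AveragingContoursRooted (ctr ctrOff ctrOff_mem_box)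
open BalabanCompositeJets (LocStencil₂ LocStencil₂.mono)
open PolarizationSign (reflSign)
open KernelReflection (refK)
open ResolventReflection (bref Φ)
open BalabanStepJetsSucc (wVH)
open Summit.QuantumFields.BalabanUV.Beta.TameKernelCalculus (Spr)
open Summit.QuantumFields.BalabanUV.Beta.ChartConjugation (conjV conjW conjW₁ conjW₂)
open Summit.QuantumFields.BalabanUV.Beta.BorderedHessian (diagK bhK stepScale)
open Summit.QuantumFields.BalabanUV.Beta.SymmetrisedStepJets (SymTables)
open Summit.QuantumFields.BalabanUV.Beta.SymShiftedSpread (bhKStepSh bhKStepSh_zero spr_bhKStepSh)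
open Summit.QuantumFields.BalabanUV.Beta.E3ContactGenerator (ctGenM ctGenM_inl)
open Summit.QuantumFields.BalabanUV.Beta.DshAn1 (Dsh spr_Dsh)
open Summit.QuantumFields.BalabanUV.Beta.SymAveragingHessianCounts (symVhSAt symHessFFAt symVhSAt_hV0_ctr)
open Summit.QuantumFields.BalabanUV.Beta.CombChartStepJets (SpureCombOf locStencil_SpureCombOf SpureCombOf_translate)
open Summit.QuantumFields.BalabanUV.Beta.SymVhSliceReflectionAn1 (hVfm_sym hVmf_sym hVmm_sym hHr_sym')
open Summit.QuantumFields.BalabanUV.Beta.SymSecondOrderTablesAn1 (symTablesAn1S2)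
open Summit.QuantumFields.BalabanUV.Beta.SecondOrderBorderClassKit (locStencil₂_conjW)
open Summit.QuantumFields.BalabanUV.Beta.SymSecondOrderSplitLoc (locStencil_diagK_mul_ctGenM locStencil₂_diagK_ctGenM_mul_ctGenM)
open Summit.QuantumFields.BalabanUV.Beta.GAN24.BiStencilZeroMode (Tab zmode)
open Summit.QuantumFields.BalabanUV.Beta.GAN24.WSlotFirstDiff (zmode_add)
open Summit.QuantumFields.BalabanUV.Beta.GAN24.CombQuarticContactChargeZero (decays_zero' locStencil₂_zero' conjW_zero_sandwich conjW_zero_letters zmode_conjW₁_eq_zero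
  zmode_conjW₂_eq_zero)
open Summit.QuantumFields.BalabanUV.Beta.GAN24.CombChartCubicCellChargeZero (mul_ctGenM_inl cubicCellCharge_SpureCombOf_eq_zero tsum_bhKStepSh_Dsh_inl_inl_row_eq_zero
  tsum_bhKStepSh_Dsh_inl_inl_col_eq_zero summable_bhKStepSh_Dsh_inl_inl_row summable_bhKStepSh_Dsh_inl_inl_col)

namespace Summit.QuantumFields.BalabanUV.Beta.GAN24.CombChartQuarticContactChargeZero

variable {Lc : ℕ} [NeZero Lc]

/-- NOT IN PRINT; OUR BOOKKEEPING.  **THE CONTACT DEFECT OF THE COMB-CHART TOWER's QUARTIC REFLECTION LAW CARRIES NO ff CHARGE** — any sym record `tabs : SymTables 3 Lc` with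
an1's first-order reflection letters (V-r) `hVfm hVmf hVmm`, (V-ff0) `hV0`, (H-r) `hHr`; every level `j`, every axis `α`, every pattern `(κ, κ′; κ₁, κ₂)`, at the pin
`(cE, cVH) = (Lc⁴, −Lc⁸∕2)`, any `cΛ`, any generator scalar `γ`, ANY second symbol `h` with `diagK (h κ u κ′ u′)` a local bi-stencil family (`hhL`) whose field leg is finitely supported at every bond pair (`hh`):
`zmode Lc (κ u κ′ u′ ↦ conjW 𝕄′_j (S′_j κ u) (S′_j κ′ u′) (diagK (γ·ctGenM κ u)) (diagK (γ·ctGenM κ′ u′)) (diagK (h κ u κ′ u′))) κ κ′ (inl κ₁) (inl κ₂) = 0`. -/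
theorem zmode_conjW_combChart_eq_zero (hLc : Odd Lc) (tabs : SymTables 3 Lc) (cΛ γ : ℝ)
    (hVfm : ∀ (α κ' : Fin 4) (u x z : Fin 4 → ℤ) (β μ : Fin 4), tabs.V κ' (bref α κ' u) x z (Sum.inl β) (Sum.inr μ) =
      (reflSign α κ' • refK (Φ (d := 3) Lc α) (tabs.V κ' u + conjV (bhK (d := 3) Lc + Dsh Lc)
        ((((Lc : ℝ) ^ 4)⁻¹) • diagK (ctGenM 3 (bhK Lc + Dsh Lc) α Lc κ' u)))) x z (Sum.inl β) (Sum.inr μ))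
    (hVmf : ∀ (α κ' : Fin 4) (u x z : Fin 4 → ℤ) (μ β : Fin 4), tabs.V κ' (bref α κ' u) x z (Sum.inr μ) (Sum.inl β) =
      (reflSign α κ' • refK (Φ (d := 3) Lc α) (tabs.V κ' u + conjV (bhK (d := 3) Lc + Dsh Lc)
        ((((Lc : ℝ) ^ 4)⁻¹) • diagK (ctGenM 3 (bhK Lc + Dsh Lc) α Lc κ' u)))) x z (Sum.inr μ) (Sum.inl β))
    (hVmm : ∀ (α κ' : Fin 4) (u x z : Fin 4 → ℤ) (μ μ' : Fin 4), tabs.V κ' (bref α κ' u) x z (Sum.inr μ) (Sum.inr μ') =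
      (reflSign α κ' • refK (Φ (d := 3) Lc α) (tabs.V κ' u + conjV (bhK (d := 3) Lc + Dsh Lc)
        ((((Lc : ℝ) ^ 4)⁻¹) • diagK (ctGenM 3 (bhK Lc + Dsh Lc) α Lc κ' u)))) x z (Sum.inr μ) (Sum.inr μ'))
    (hV0 : ∀ (κ : Fin 4) (w x z : Fin 4 → ℤ) (β β' : Fin 4), tabs.V κ w x z (Sum.inl β) (Sum.inl β') = 0)
    (hHr : ∀ (α' μ : Fin 4) (y : Fin 4 → ℤ), tabs.H μ (bref α' μ y) = reflSign α' μ • refK (Φ (d := 3) Lc α') (tabs.H μ y))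
    (j : ℕ) (α : Fin 4)
    (h : Fin 4 → (Fin 4 → ℤ) → Fin 4 → (Fin 4 → ℤ) → (Fin 4 → ℤ) → Fib 3 → ℝ)
    (hhL : ∃ C δ : ℝ, 0 < δ ∧ LocStencil₂ (fun κ u κ' u' => diagK (h κ u κ' u')) C δ)
    (hh : ∀ (κ : Fin 4) (u : Fin 4 → ℤ) (κ' : Fin 4) (u' : Fin 4 → ℤ), ∃ s : Finset (Fin 4 → ℤ), ∀ x ∉ s, ∀ (β : Fin 4), h κ u κ' u' x (Sum.inl β) = 0)
    (κ κ' κ₁ κ₂ : Fin 4) :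
    zmode Lc (fun κ u κ' u' =>
        conjW (bhKStepSh 3 Lc (Dsh Lc) j)
          (SpureCombOf tabs ((Lc : ℝ) ^ 4) (-((Lc : ℝ) ^ 8 / 2)) cΛ j κ u)
          (SpureCombOf tabs ((Lc : ℝ) ^ 4) (-((Lc : ℝ) ^ 8 / 2)) cΛ j κ' u')
          (diagK fun p a => γ * ctGenM 3 (bhK Lc + Dsh Lc) α Lc κ u p a) (diagK fun p a => γ * ctGenM 3 (bhK Lc + Dsh Lc) α Lc κ' u' p a)
          (diagK (h κ u κ' u')))
      κ κ' (Sum.inl κ₁) (Sum.inl κ₂) = 0 := by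
  classical
  have hL1 : 1 ≤ Lc := hLc.pos
  -- classes at one common rate
  obtain ⟨Cs, δs, hδs, hS⟩ := locStencil_SpureCombOf tabs ((Lc : ℝ) ^ 4) (-((Lc : ℝ) ^ 8 / 2)) cΛ j
  obtain ⟨C𝕄, δ𝕄, hδ𝕄, h𝕄⟩ := spr_bhKStepSh (d := 3) (Lc := Lc) (spr_Dsh hL1) j
  have hBsp : Spr (bhK (d := 3) Lc + Dsh Lc) := by
    simpa only [bhKStepSh_zero] using spr_bhKStepSh (d := 3) (Lc := Lc) (spr_Dsh hL1) 0
  obtain ⟨CB, δB, hδB, hB⟩ := hBsp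
  obtain ⟨C2, δh, hδh, hX₂0⟩ := hhL
  set δ : ℝ := min (min δs δ𝕄) (min (δB / 2) δh) with hδdef
  have hδ : 0 < δ := lt_min (lt_min hδs hδ𝕄) (lt_min (by linarith) hδh)
  have hδs' : δ ≤ δs := (min_le_left _ _).trans (min_le_left _ _)
  have hδ𝕄' : δ ≤ δ𝕄 := (min_le_left _ _).trans (min_le_right _ _)
  have hδB' : 2 * δ ≤ δB := by have := (min_le_right (min δs δ𝕄) (min (δB / 2) δh)).trans (min_le_left _ _); linarith
  have hδh' : δ ≤ δh := (min_le_right _ _).trans (min_le_right _ _)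
  have hCs : 0 ≤ Cs := (hS 0 0).nonneg (Sum.inl 0)
  have hC𝕄 : 0 ≤ C𝕄 := h𝕄.nonneg (Sum.inl 0)
  have hCB : 0 ≤ CB := hB.nonneg (Sum.inl 0)
  have hS' : LocStencil (SpureCombOf tabs ((Lc : ℝ) ^ 4) (-((Lc : ℝ) ^ 8 / 2)) cΛ j) Cs δ := locStencil_mono hS hCs hδs'
  have h𝕄' : Decays (bhKStepSh 3 Lc (Dsh Lc) j) C𝕄 δ := decays_mono h𝕄 hC𝕄 le_rfl hδ𝕄'
  have hB2 : Decays (bhK (d := 3) Lc + Dsh Lc) CB (2 * δ) := decays_mono hB hCB le_rfl hδB'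
  have hX := locStencil_diagK_mul_ctGenM (d := 3) hB2 (by linarith) γ α Lc
  have e2 : 2 * δ / 2 = δ := by ring
  rw [e2] at hX
  have hX₂ : LocStencil₂ (fun κ u κ' u' => diagK (h κ u κ' u')) C2 δ := hX₂0.mono hδh'
  -- the two halves are `LocStencil₂` (an2's kit with zero letters)
  obtain ⟨C₁, hJ₁⟩ := locStencil₂_conjW (decays_zero' (d := 3) (δ := δ) le_rfl) hS' hX (locStencil₂_zero' (d := 3) δ) hδ
  obtain ⟨C₂, hJ₂⟩ := locStencil₂_conjW h𝕄' (Summit.QuantumFields.BalabanUV.Beta.D1BFx.LiteralStencilSockets.locStencil_zero (d := 3) (δ := δ) le_rfl) hX hX₂ hδ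
  simp only [conjW_zero_sandwich] at hJ₁
  simp only [conjW_zero_letters] at hJ₂
  -- split the defect and its charge
  have e : zmode Lc (fun κ u κ' u' =>
        conjW (bhKStepSh 3 Lc (Dsh Lc) j)
          (SpureCombOf tabs ((Lc : ℝ) ^ 4) (-((Lc : ℝ) ^ 8 / 2)) cΛ j κ u)
          (SpureCombOf tabs ((Lc : ℝ) ^ 4) (-((Lc : ℝ) ^ 8 / 2)) cΛ j κ' u')
          (diagK fun p a => γ * ctGenM 3 (bhK Lc + Dsh Lc) α Lc κ u p a) (diagK fun p a => γ * ctGenM 3 (bhK Lc + Dsh Lc) α Lc κ' u' p a)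
          (diagK (h κ u κ' u'))) κ κ' (Sum.inl κ₁) (Sum.inl κ₂)
      = zmode Lc (fun κ u κ' u' =>
          conjW₁ (SpureCombOf tabs ((Lc : ℝ) ^ 4) (-((Lc : ℝ) ^ 8 / 2)) cΛ j κ u)
              (SpureCombOf tabs ((Lc : ℝ) ^ 4) (-((Lc : ℝ) ^ 8 / 2)) cΛ j κ' u')
              (diagK fun p a => γ * ctGenM 3 (bhK Lc + Dsh Lc) α Lc κ u p a) (diagK fun p a => γ * ctGenM 3 (bhK Lc + Dsh Lc) α Lc κ' u' p a)
            + conjW₂ (bhKStepSh 3 Lc (Dsh Lc) j)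
              (diagK fun p a => γ * ctGenM 3 (bhK Lc + Dsh Lc) α Lc κ u p a) (diagK fun p a => γ * ctGenM 3 (bhK Lc + Dsh Lc) α Lc κ' u' p a)
              (diagK (h κ u κ' u'))) κ κ' (Sum.inl κ₁) (Sum.inl κ₂) := rfl
  rw [e, zmode_add (N := Lc) hJ₁ hJ₂ (by positivity) κ κ' (Sum.inl κ₁) (Sum.inl κ₂)]
  -- the `conjW₁` half: zero cubic cell charges (M1′ `CombChartCubicCellChargeZero`)
  rw [zmode_conjW₁_eq_zero (N := Lc) (c := fun κ => if κ = α then -γ else 0) hS' hδ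
      (SpureCombOf_translate tabs _ _ cΛ j) (cubicCellCharge_SpureCombOf_eq_zero hLc tabs cΛ hVfm hVmf hVmm hV0 hHr j)
      (fun κ u x β => mul_ctGenM_inl (bhK Lc + Dsh Lc) γ α κ u x β) κ κ' κ₁ κ₂]
  -- the `conjW₂` half: the shifted spread's Ward zeros (transferred from the rooted step kernel)
  rw [zmode_conjW₂_eq_zero (N := Lc) (c := fun κ => if κ = α then -γ else 0) (fun κ u x β => mul_ctGenM_inl (bhK Lc + Dsh Lc) γ α κ u x β) hh
      (fun x a b => summable_bhKStepSh_Dsh_inl_inl_row hL1 j x a b) (fun z a b => summable_bhKStepSh_Dsh_inl_inl_col hL1 j z a b)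
      (fun x a b => tsum_bhKStepSh_Dsh_inl_inl_row_eq_zero j x a b) (fun z a b => tsum_bhKStepSh_Dsh_inl_inl_col_eq_zero j z a b) κ κ' κ₁ κ₂, add_zero]

/-- NOT IN PRINT; OUR BOOKKEEPING.  **THE CANONICAL PRODUCT SECOND SYMBOL** `h κ u κ′ u′ = (γ₂·ctGenM κ u)·(γ₂′·ctGenM κ′ u′)`: both side conditions of the previous theorem are
theorems (an2's `SymSecondOrderSplitLoc.locStencil₂_diagK_ctGenM_mul_ctGenM`; the field leg is supported at the first bond by `ctGenM_inl`). -/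
theorem zmode_conjW_combChart_canon_eq_zero (hLc : Odd Lc) (tabs : SymTables 3 Lc) (cΛ γ γ₂ γ₂' : ℝ)
    (hVfm : ∀ (α κ' : Fin 4) (u x z : Fin 4 → ℤ) (β μ : Fin 4), tabs.V κ' (bref α κ' u) x z (Sum.inl β) (Sum.inr μ) =
      (reflSign α κ' • refK (Φ (d := 3) Lc α) (tabs.V κ' u + conjV (bhK (d := 3) Lc + Dsh Lc)
        ((((Lc : ℝ) ^ 4)⁻¹) • diagK (ctGenM 3 (bhK Lc + Dsh Lc) α Lc κ' u)))) x z (Sum.inl β) (Sum.inr μ))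
    (hVmf : ∀ (α κ' : Fin 4) (u x z : Fin 4 → ℤ) (μ β : Fin 4), tabs.V κ' (bref α κ' u) x z (Sum.inr μ) (Sum.inl β) =
      (reflSign α κ' • refK (Φ (d := 3) Lc α) (tabs.V κ' u + conjV (bhK (d := 3) Lc + Dsh Lc)
        ((((Lc : ℝ) ^ 4)⁻¹) • diagK (ctGenM 3 (bhK Lc + Dsh Lc) α Lc κ' u)))) x z (Sum.inr μ) (Sum.inl β))
    (hVmm : ∀ (α κ' : Fin 4) (u x z : Fin 4 → ℤ) (μ μ' : Fin 4), tabs.V κ' (bref α κ' u) x z (Sum.inr μ) (Sum.inr μ') =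
      (reflSign α κ' • refK (Φ (d := 3) Lc α) (tabs.V κ' u + conjV (bhK (d := 3) Lc + Dsh Lc)
        ((((Lc : ℝ) ^ 4)⁻¹) • diagK (ctGenM 3 (bhK Lc + Dsh Lc) α Lc κ' u)))) x z (Sum.inr μ) (Sum.inr μ'))
    (hV0 : ∀ (κ : Fin 4) (w x z : Fin 4 → ℤ) (β β' : Fin 4), tabs.V κ w x z (Sum.inl β) (Sum.inl β') = 0)
    (hHr : ∀ (α' μ : Fin 4) (y : Fin 4 → ℤ), tabs.H μ (bref α' μ y) = reflSign α' μ • refK (Φ (d := 3) Lc α') (tabs.H μ y))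
    (j : ℕ) (α κ κ' κ₁ κ₂ : Fin 4) :
    zmode Lc (fun κ u κ' u' =>
        conjW (bhKStepSh 3 Lc (Dsh Lc) j)
          (SpureCombOf tabs ((Lc : ℝ) ^ 4) (-((Lc : ℝ) ^ 8 / 2)) cΛ j κ u)
          (SpureCombOf tabs ((Lc : ℝ) ^ 4) (-((Lc : ℝ) ^ 8 / 2)) cΛ j κ' u')
          (diagK fun p a => γ * ctGenM 3 (bhK Lc + Dsh Lc) α Lc κ u p a) (diagK fun p a => γ * ctGenM 3 (bhK Lc + Dsh Lc) α Lc κ' u' p a)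
          (diagK fun p a => (γ₂ * ctGenM 3 (bhK Lc + Dsh Lc) α Lc κ u p a) * (γ₂' * ctGenM 3 (bhK Lc + Dsh Lc) α Lc κ' u' p a)))
      κ κ' (Sum.inl κ₁) (Sum.inl κ₂) = 0 := by
  classical
  have hL1 : 1 ≤ Lc := hLc.pos
  have hBsp : Spr (bhK (d := 3) Lc + Dsh Lc) := by
    simpa only [bhKStepSh_zero] using spr_bhKStepSh (d := 3) (Lc := Lc) (spr_Dsh hL1) 0
  obtain ⟨CB, δB, hδB, hB⟩ := hBsp
  refine zmode_conjW_combChart_eq_zero hLc tabs cΛ γ hVfm hVmf hVmm hV0 hHr j α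
    (fun κ u κ' u' p a => (γ₂ * ctGenM 3 (bhK Lc + Dsh Lc) α Lc κ u p a) * (γ₂' * ctGenM 3 (bhK Lc + Dsh Lc) α Lc κ' u' p a)) ?_ ?_ κ κ' κ₁ κ₂
  · -- a local bi-stencil family at rate `δB ∕ 3` (an2's class of the product symbol)
    exact ⟨_, δB / 3, by positivity, locStencil₂_diagK_ctGenM_mul_ctGenM (d := 3) hB hδB.le γ₂ γ₂' α Lc⟩
  · -- the field leg is supported at the first bond
    intro κ u κ' u'
    refine ⟨{u}, fun x hx β => ?_⟩
    rw [Finset.mem_singleton] at hx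
    rw [ctGenM_inl, if_neg (fun h => hx h.1), mul_zero, zero_mul]

/-- NOT IN PRINT; OUR BOOKKEEPING.  **THE SAME AT an1's RECORD `symTablesAn1S2 3 Lc cΛt`, HYPOTHESES `Odd Lc` ONLY** (generic second symbol `h` with its two displayed side conditions;
the five first-order letters are an1's theorems `SymVhSliceReflectionAn1.hVfm_sym ∕ hVmf_sym ∕ hVmm_sym ∕ hHr_sym'`, `SymAveragingHessianCounts.symVhSAt_hV0_ctr`). -/
theorem zmode_conjW_combChart_an1_eq_zero (hLc : Odd Lc) (cΛt cΛ γ : ℝ) (j : ℕ) (α : Fin 4)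
    (h : Fin 4 → (Fin 4 → ℤ) → Fin 4 → (Fin 4 → ℤ) → (Fin 4 → ℤ) → Fib 3 → ℝ)
    (hhL : ∃ C δ : ℝ, 0 < δ ∧ LocStencil₂ (fun κ u κ' u' => diagK (h κ u κ' u')) C δ)
    (hh : ∀ (κ : Fin 4) (u : Fin 4 → ℤ) (κ' : Fin 4) (u' : Fin 4 → ℤ), ∃ s : Finset (Fin 4 → ℤ), ∀ x ∉ s, ∀ (β : Fin 4), h κ u κ' u' x (Sum.inl β) = 0)
    (κ κ' κ₁ κ₂ : Fin 4) :
    zmode Lc (fun κ u κ' u' =>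
        conjW (bhKStepSh 3 Lc (Dsh Lc) j)
          (SpureCombOf (symTablesAn1S2 3 Lc cΛt) ((Lc : ℝ) ^ 4) (-((Lc : ℝ) ^ 8 / 2)) cΛ j κ u)
          (SpureCombOf (symTablesAn1S2 3 Lc cΛt) ((Lc : ℝ) ^ 4) (-((Lc : ℝ) ^ 8 / 2)) cΛ j κ' u')
          (diagK fun p a => γ * ctGenM 3 (bhK Lc + Dsh Lc) α Lc κ u p a) (diagK fun p a => γ * ctGenM 3 (bhK Lc + Dsh Lc) α Lc κ' u' p a)
          (diagK (h κ u κ' u')))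
      κ κ' (Sum.inl κ₁) (Sum.inl κ₂) = 0 :=
  zmode_conjW_combChart_eq_zero hLc (symTablesAn1S2 3 Lc cΛt) cΛ γ (hVfm_sym hLc) (hVmf_sym hLc) (hVmm_sym hLc) (symVhSAt_hV0_ctr (d := 3) Lc) (hHr_sym' hLc)
    j α h hhL hh κ κ' κ₁ κ₂

end Summit.QuantumFields.BalabanUV.Beta.GAN24.CombChartQuarticContactChargeZero

end
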